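import Literature.Topology.FourManifolds.CouplePassage
import Literature.Topology.FourManifolds.BoundaryPlanarisationCores
import Literature.Topology.FourManifolds.RotationBody

/-!
# Rigidity of the direction map from its germs at the core directions; the cone of a
# diffeomorphism of the sphere of directions

Topic `Literature/Topology/FourManifolds` (tenth file of the *structure conjugacy* of two
one-level Morse data on a handlebody, support of `stmt-SmoothPoincare4-15190`; dimension `3`,
saddles of index `1`).  Everything here is **proved**; the one new definition is the cone of a map
of the unit sphere.

For a couple `C` on a `3`-manifold with saddle data `Q` whose boxes have index `1`, the entrance
sets of the saddles are swept by the entrance-sheet points `QA.entW s b y`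
(`BoundaryPlanarisationCores.lean`), the model conjugation carries them to the entrance-sheet
points of `σ s` (`MC_entW`), and so **rigidity of a direction map `T` at `s`
(`TRigid`, `CouplePassage.lean`) follows from the identity `T (QA.entDir s b y) = QB.entDir (σ s) b y`
for small `y`** (`tRigid_of_forall_entDir`).  For `T = sphereCone φ`, the cone
`v ↦ ‖v‖ • φ (v/‖v‖)` of a map `φ` of the unit sphere, this is a condition on the germs of `φ` at
the `2g` unit core directions (`tRigid_sphereCone`); the cone preserves norms, is smooth off the
origin for smooth `φ`, and cones of inverse maps are inverse (`sphereCone_sphereCone`).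

## References

* J. Milnor, *Lectures on the h-cobordism theorem* (1965), Def. 3.9, Thm. 4.1, proofs of
  Thms. 3.12–3.13 (PDF pp. 16–22). [MilnorHCobordism1965]
-/

open scoped Manifold ContDiff Topology
open Set Function Filter Metric

noncomputable section

namespace Literature.Topology.FourManifolds

open Cobordism FourManifolds.Flow

universe u

/-! ### Entrance-sheet points of the model -/

namespace TracePolar

attribute [local instance] fact_finrank_euclideanSpace_succ

/-- Local notation for the model plane and space. -/
local notation "E2" => EuclideanSpace ℝ (Fin 2)
local notation "E3" => EuclideanSpace ℝ (Fin 3)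

/-- **Every point of the entrance sheet `{-x₁² + |y⃗|² = -ε²}` is `entPoint ε b (y⃗)`** for the end
`b = (0 < x₁)`. [cite: MilnorHCobordism1965, proof of Thm. 3.12 (PDF p. 18)] -/
theorem exists_eq_entPoint_of_milnorQuadratic_eq {ε : ℝ} (hε : 0 < ε) {u : E3} (hQ : milnorQuadratic 1 u = -ε ^ 2) :
    ∃ b : Bool, u = entPoint ε b (yv u) := by
  have hx : u 0 ^ 2 = ε ^ 2 + ‖yv u‖ ^ 2 := by rw [milnorQuadratic_one] at hQ; linarith
  have hpos : 0 < ε ^ 2 + ‖yv u‖ ^ 2 := by positivity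
  by_cases h0 : 0 < u 0
  · refine ⟨true, ?_⟩
    have h1 : Real.sqrt (ε ^ 2 + ‖yv u‖ ^ 2) = u 0 := by rw [← hx, Real.sqrt_sq h0.le]
    conv_lhs => rw [← mk3_zero_yv u]
    rw [entPoint]; simp [boolSign, h1]
  · refine ⟨false, ?_⟩
    have h1 : Real.sqrt (ε ^ 2 + ‖yv u‖ ^ 2) = -u 0 := by
      rw [← hx, show u 0 ^ 2 = (-u 0) ^ 2 by ring, Real.sqrt_sq (by linarith [not_lt.1 h0])]
    conv_lhs => rw [← mk3_zero_yv u]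
    rw [entPoint]; simp [boolSign, h1]

/-! ### The cone of a map of the unit sphere -/

/-- **The unit vector map** `w ↦ w / ‖w‖` as a vector-valued map (junk unit value at the origin). [folklore] -/
def unitVecFun (w : E3) : E3 := if w = 0 then EuclideanSpace.single 0 1 else ‖w‖⁻¹ • w

/-- The unit vector map takes unit values. [folklore] -/
theorem unitVecFun_mem (w : E3) : unitVecFun w ∈ Metric.sphere (0 : E3) 1 := by
  by_cases h : w = 0
  · rw [unitVecFun, if_pos h, mem_sphere_zero_iff_norm]; simp
  · rw [unitVecFun, if_neg h, mem_sphere_zero_iff_norm, norm_smul, norm_inv, norm_norm, inv_mul_cancel₀ (norm_ne_zero_iff.2 h)]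

/-- **The unit vector map** into the unit sphere. [folklore] -/
def unitVec : E3 → Metric.sphere (0 : E3) 1 := Set.codRestrict unitVecFun _ unitVecFun_mem

/-- The unit vector map off the origin, in coordinates. [folklore] -/
theorem coe_unitVec {w : E3} (h : w ≠ 0) : (unitVec w : E3) = ‖w‖⁻¹ • w := by
  show unitVecFun w = _
  rw [unitVecFun, if_neg h]

/-- The unit vector of a positive multiple of a unit vector. [folklore] -/
theorem unitVec_smul_coe {t : ℝ} (ht : 0 < t) (u : Metric.sphere (0 : E3) 1) : unitVec (t • (u : E3)) = u := by
  have hu : ‖(u : E3)‖ = 1 := by rw [← mem_sphere_zero_iff_norm]; exact u.2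
  have h0 : t • (u : E3) ≠ 0 := smul_ne_zero ht.ne' (ne_zero_of_mem_unit_sphere u)
  apply Subtype.ext
  rw [coe_unitVec h0, norm_smul, Real.norm_of_nonneg ht.le, hu, mul_one, smul_smul, inv_mul_cancel₀ ht.ne', one_smul]

/-- **The unit vector map is smooth off the origin** (as a map into the sphere). [folklore] -/
theorem contMDiffOn_unitVec : ContMDiffOn 𝓘(ℝ, E3) (𝓡 2) ∞ unitVec {w : E3 | w ≠ 0} := by
  have hf : ContMDiffOn 𝓘(ℝ, E3) 𝓘(ℝ, E3) ∞ unitVecFun {w | w ≠ 0} := by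
    have h1 : ContDiffOn ℝ ∞ (fun w : E3 => ‖w‖⁻¹ • w) {w | w ≠ 0} := fun w hw =>
      (((contDiffAt_norm ℝ hw).inv (norm_ne_zero_iff.2 hw)).smul contDiffAt_id).contDiffWithinAt
    exact (h1.congr fun w hw => by show unitVecFun w = _; rw [unitVecFun, if_neg hw]).contMDiffOn
  exact contMDiffOn_codRestrict_sphere isOpen_ne hf _

/-- **The cone** `w ↦ ‖w‖ • φ (w / ‖w‖)` of a self-map `φ` of the unit sphere (`0 ↦ 0`). [cite: CerfDiffeoSphere1968, Ch. I §1, Lemme 2] -/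
def sphereCone (φ : Metric.sphere (0 : E3) 1 → Metric.sphere (0 : E3) 1) (w : E3) : E3 := ‖w‖ • (φ (unitVec w) : E3)

variable {φ φ' : Metric.sphere (0 : E3) 1 → Metric.sphere (0 : E3) 1}

/-- Unfolding `sphereCone`. [folklore] -/
theorem sphereCone_def (w : E3) : sphereCone φ w = ‖w‖ • (φ (unitVec w) : E3) := rfl

/-- The cone at the origin. [folklore] -/
@[simp] theorem sphereCone_zero : sphereCone φ 0 = 0 := by rw [sphereCone_def, norm_zero, zero_smul]

/-- **The cone on positive multiples of unit vectors**: `sphereCone φ (t • u) = t • φ u`. [folklore] -/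
theorem sphereCone_smul_coe {t : ℝ} (ht : 0 < t) (u : Metric.sphere (0 : E3) 1) :
    sphereCone φ (t • (u : E3)) = t • (φ u : E3) := by
  have hu : ‖(u : E3)‖ = 1 := by rw [← mem_sphere_zero_iff_norm]; exact u.2
  rw [sphereCone_def, unitVec_smul_coe ht, norm_smul, Real.norm_of_nonneg ht.le, hu, mul_one]

/-- **The cone preserves the norm.** [folklore] -/
theorem norm_sphereCone (w : E3) : ‖sphereCone φ w‖ = ‖w‖ := by
  rw [sphereCone_def, norm_smul, norm_norm, mem_sphere_zero_iff_norm.1 (φ (unitVec w)).2, mul_one]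

/-- A non-zero vector is a positive multiple of its unit vector. [folklore] -/
theorem eq_norm_smul_unitVec {w : E3} (h : w ≠ 0) : w = ‖w‖ • (unitVec w : E3) := by
  rw [coe_unitVec h, smul_smul, mul_inv_cancel₀ (norm_ne_zero_iff.2 h), one_smul]

/-- **Cones of inverse maps are inverse.** [folklore] -/
theorem sphereCone_sphereCone (h : LeftInverse φ' φ) (w : E3) : sphereCone φ' (sphereCone φ w) = w := by
  by_cases hw : w = 0
  · rw [hw, sphereCone_zero, sphereCone_zero]
  · have hn : 0 < ‖w‖ := norm_pos_iff.2 hw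
    have h1 : sphereCone φ w = ‖w‖ • (φ (unitVec w) : E3) := rfl
    rw [h1, sphereCone_smul_coe hn, h]
    exact (eq_norm_smul_unitVec hw).symm

/-- **The cone of a smooth map of the sphere is smooth off the origin.** [folklore] -/
theorem contDiffAt_sphereCone (hφ : ContMDiff (𝓡 2) (𝓡 2) ∞ φ) {v : E3} (hv : v ≠ 0) : ContDiffAt ℝ ∞ (sphereCone φ) v := by
  have h1 : ContMDiffOn 𝓘(ℝ, E3) 𝓘(ℝ, E3) ∞ (fun w => ((φ (unitVec w) : Metric.sphere (0 : E3) 1) : E3)) {w : E3 | w ≠ 0} :=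
    (contMDiff_coe_sphere.comp hφ).comp_contMDiffOn contMDiffOn_unitVec
  have h2 : ContMDiffOn 𝓘(ℝ, E3) 𝓘(ℝ, ℝ) ∞ (fun w : E3 => ‖w‖) {w : E3 | w ≠ 0} := fun w hw =>
    (contDiffAt_norm ℝ hw).contMDiffAt.contMDiffWithinAt
  have h3 : ContMDiffOn 𝓘(ℝ, E3) 𝓘(ℝ, E3) ∞ (sphereCone φ) {w : E3 | w ≠ 0} := h2.smul h1
  exact contMDiffAt_iff_contDiffAt.1 ((h3 v hv).contMDiffAt (isOpen_ne.mem_nhds hv))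

/-- **The cone on vectors of norm `r`**: `sphereCone φ v = r • φ (unitVec v)`. [folklore] -/
theorem sphereCone_of_norm_eq {v : E3} {r : ℝ} (hv : ‖v‖ = r) : sphereCone φ v = r • (φ (unitVec v) : E3) := by
  rw [sphereCone_def, hv]

end TracePolar

/-! ### Entrance-sheet points of one-level saddle data -/

namespace BasinPair.SaddleData

open TracePolar

variable {W : Type u} [TopologicalSpace W] [T2Space W] [SecondCountableTopology W]
  [CompactSpace W] [ChartedSpace (EuclideanHalfSpace (2 + 1)) W] [IsManifold (𝓡∂ (2 + 1)) ∞ W]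
  {g : W → ℝ} {ξA ξB : Π x : W, TangentSpace (𝓡∂ (2 + 1)) x} {P : BasinPair g ξA ξB} (Q : P.SaddleData)

/-- Local notation for the model plane. -/
local notation "E2" => EuclideanSpace ℝ (Fin 2)

/-- **Every point of the entrance set of `s` on the entrance level is an entrance-sheet point**
`entW s b y` with `‖y‖² < δ` (boxes of index `1`). [cite: MilnorHCobordism1965, proof of Thm. 3.12 (PDF p. 18)] -/
theorem exists_eq_entW_of_mem_Uent {s : SaddlePt 2 g} (hk : (Q.DA s).k = 1) {δ : ℝ} {e : W} (he : e ∈ Q.Uent s δ)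
    (heℓ : g e = Q.c - Q.ε ^ 2) : ∃ b y, ‖y‖ ^ 2 < δ ∧ e = Q.entW s b y := by
  set u := (Q.DA s).coord e with hu
  have hQ : milnorQuadratic 1 u = -Q.ε ^ 2 := by
    have h := Q.apply_eq_of_mem_chartBall he.1; rw [heℓ, hk] at h; linarith
  obtain ⟨b', hb'⟩ := exists_eq_entPoint_of_milnorQuadratic_eq Q.ε_pos hQ
  have hy' : ‖yv u‖ ^ 2 < δ := by
    have h := he.2; rw [hk, ← hu, hb', sqSumGE_entPoint] at h; exact h
  refine ⟨b', yv u, hy', ?_⟩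
  have h1 : e = (Q.DA s).pt u := ((Q.DA s).pt_coord_of_mem_chartBall he.1).symm
  rw [h1, hb']
  rfl

end BasinPair.SaddleData

/-! ### Entrance-sheet points of a couple and rigidity -/

namespace BasinCouple

namespace SaddleData

open TracePolar

variable {W : Type u} [TopologicalSpace W] [T2Space W] [SecondCountableTopology W]
  [CompactSpace W] [ChartedSpace (EuclideanHalfSpace (2 + 1)) W] [IsManifold (𝓡∂ (2 + 1)) ∞ W]
  {gA gB : W → ℝ} {ξA ξB : Π x : W, TangentSpace (𝓡∂ (2 + 1)) x} {C : BasinCouple gA gB ξA ξB}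
  (Q : C.SaddleData)

/-- Local notation for the model plane and space. -/
local notation "E2" => EuclideanSpace ℝ (Fin 2)
local notation "E3" => EuclideanSpace ℝ (Fin 3)

variable {s : SaddlePt 2 gA} (hkA : (Q.QA.DA s).k = 1) {b : Bool} {y : E2}

/-- **The model conjugation carries the entrance-sheet points of `s` to those of `σ s`** (same
Milnor coordinates). [cite: MilnorHCobordism1965, proof of Thm. 3.13 (PDF pp. 18–19)] -/
theorem MC_entW (hy : ‖y‖ ^ 2 < Q.QA.ε ^ 2) : Q.MC s (Q.QA.entW s b y) = Q.QB.entW (Q.σ s) b y := by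
  obtain ⟨-, hcoord⟩ := Q.QA.entW_mem_chartBall (s := s) (b := b) hy
  rw [MC_def, MilnorBox.chartMap, hcoord]
  show _ = ((Q.QB.DA (Q.σ s)).chart.extend (𝓡∂ (2 + 1))).symm ((Q.QB.DA (Q.σ s)).center + entPoint Q.QB.ε b y)
  rw [Q.εB_eq]

include hkA in
/-- **Rigidity from the entrance charts**: if `T (QA.entDir s b y) = QB.entDir (σ s) b y` for all
`‖y‖² < δ` (`δ ≤ ε²`), then `T` is rigid at `s` with width `δ`. [cite: MilnorHCobordism1965, proof of Thm. 3.13 (PDF pp. 18–19)] -/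
theorem tRigid_of_forall_entDir {T : E3 → E3} {δ : ℝ} (hδ : δ ≤ Q.QA.ε ^ 2)
    (h : ∀ (b : Bool) (y : E2), ‖y‖ ^ 2 < δ → T (Q.QA.entDir s b y) = Q.QB.entDir (Q.σ s) b y) : Q.TRigid T s δ := by
  intro e he heℓ
  obtain ⟨b, y, hy, rfl⟩ := Q.QA.exists_eq_entW_of_mem_Uent hkA he heℓ
  rw [Q.MC_entW (hy.trans_le hδ)]
  show Q.QB.entDir (Q.σ s) b y = T (Q.QA.entDir s b y)
  exact (h b y hy).symm

/-! ### Rigidity of the cone of a map of directions -/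

include hkA in
/-- The entrance directions are non-zero. [folklore] -/
theorem entDir_ne_zero (hy : ‖y‖ ^ 2 < Q.QA.ε ^ 2) : Q.QA.entDir s b y ≠ 0 := by
  rw [← norm_pos_iff, Q.QA.norm_entDir hkA hy]; exact C.A.rad_pos

include hkA in
/-- **The cone of `φ` is rigid at `s` with width `δ ≤ ε²` as soon as `φ` carries the unit entrance
directions of `s` to those of `σ s`** for `‖y‖² < δ`. [cite: MilnorHCobordism1965, proof of Thm. 3.13 (PDF pp. 18–19)] -/
theorem tRigid_sphereCone {φ : Metric.sphere (0 : E3) 1 → Metric.sphere (0 : E3) 1} {δ : ℝ} (hδ : δ ≤ Q.QA.ε ^ 2)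
    (h : ∀ (b : Bool) (y : E2), ‖y‖ ^ 2 < δ →
      (φ (unitVec (Q.QA.entDir s b y)) : E3) = C.A.rad⁻¹ • Q.QB.entDir (Q.σ s) b y) :
    Q.TRigid (sphereCone φ) s δ := by
  refine Q.tRigid_of_forall_entDir hkA hδ fun b y hy => ?_
  have hyε : ‖y‖ ^ 2 < Q.QA.ε ^ 2 := hy.trans_le hδ
  rw [sphereCone_of_norm_eq (Q.QA.norm_entDir hkA hyε), h b y hy, smul_smul,
    show (BasinPair.diag C.A).A.rad * C.A.rad⁻¹ = 1 from mul_inv_cancel₀ C.A.rad_pos.ne', one_smul]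

end SaddleData

end BasinCouple

end Literature.Topology.FourManifolds
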